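import Literature.NumberTheory.LFunctions.Zhang2022.DetectorMainTermForm
import Literature.NumberTheory.LFunctions.Zhang2022.RepairFrakc3S

/-!
# Zhang (2022), programme F-S3 (cell landau-siegel, family B-det): the formula-II GLUE block of a detector recipe —
# `F₀` with free glue weights `W′`, the two-sided recipe form, and faithfulness to the `𝔠₃` block of record

Y. Zhang, *Discrete mean estimates and the Landau–Siegel zero*, arXiv:2211.02515v1 [Zhang2022LandauSiegel] —
an unrefereed manuscript under adjudication. **WHAT THIS IS NOT: not a claim about Theorems 1–2 of
arXiv:2211.02515, about Landau–Siegel zeros, or about Parity; nothing here asserts any claim of the manuscript.**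
«The programme SEARCHES and TYPES; no claim about Landau–Siegel zeros, Theorems 1–2 of arXiv:2211.02515 or a
repaired Margin232 until a kernel theorem says so.»

Second half of definition request **D-det-1** (the cell's `OBJECTIVE.md` §3.4; the «formula-II/glue `W′_j(S)`»
item left open in `DetectorMainTermForm`). A TWO-SIDED design `𝔥 = H₁ + Z·H̄₂` pairs the side-1 profile `g₁`
with the reflected side-2 profile `R̃g₂`; at the printed detector the main term of that cross pairing is
`P(g₁, R̃g₂) = F₀ + (window form)` (`Repair.mainTermFormPolar_refl_eq`, `Repair.frakc3S_eq`), where the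
boundary/primitive block is formula II of the manuscript (Prop 14.1 + Lemma 15.1 + §§16–17, audit dictionary
STRUCTURE §3): `F₀(a,b) = −i[Σ_j W′_j e_j(a)e_j(b) + a(0⁺)b(0⁺)]`, `e_j(g) = g(0⁺) − iπb_j∫g`, glue weights
`W′ = (3,3,1)` (the tree's `Repair.F0gen` / `Repair.F0part`, `Repair.F0part_eq_weights`). This file makes the
glue weights a PARAMETER:

* `eDet b_j (g(0⁺)) (∫g) = g(0⁺) − iπb_j∫g` (Lemma 15.1's functional on the profile data), `F0Det W′ b` (the block
  with glue recipe `W′` and first-slot shift multiples `b`), `zhangGlueW = (3,3,1)`, and PROVED faithfulness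
  `F0Det_zhang : F0Det zhangGlueW zhangRecipe.b a I_a b I_b = Repair.F0gen a b I_a I_b` (pure algebra);
* the CANDIDATE glue weights of a shift triple, `shiftGlueW b j = W_j(b)·n_j(b)/b_j` — the identity
  `j·W′_j = W_j·b′_j·b″_j` that STRUCTURE §3 records AT THE PRINTED TRIPLE (`3 = ½·6`, `6 = 2·3`, `3 = (3/2)·2`),
  continued to general `b` with the typed formula-I weights `Det.shiftW` (`shiftGlueW_std : = (3,3,1)` at
  `b = (1,2,3)`, PROVED). DERIVATION STATUS: formula II (the residues of (15.16), the `e`-functionals of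
  Lemma 15.1, §§16–17) has NOT been re-derived for a general shift triple by anyone in the cell — this is a
  candidate SHAPE for the registry row, labelled «derivation (in-house): OPEN», not a claim;
* `FormDetTwoSided R W′ g₁ g₂ = 𝔅_R(g₁) + 𝔅_R(g₂) + 2Re F₀_{W′,b}(g₁(0), ∫g₁; g₂(0), ∫g₂)` — the assembled main-term
  form of a two-sided design WITHOUT the overlap/window term (exact when the side supports do not overlap
  after reflection, `ν₁ + ν₂ ≤ 1`; STRUCTURE §3 «Assembly»), and PROVED on the admissible class `R`:
  `FormDetTwoSided_zhang : … = Re 𝔠₁T + Re 𝔠₂T + 2Re F0part` and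
  `FormDetTwoSided_zhang_eq_C232S_sub : … = C232S θ − 2Re WT θ` — i.e. at the printed recipe it is the §18
  functional of record (`Repair.C232S`) minus exactly the window form `Repair.WT` (integrals over the
  overlaps `[1−ν₂, ν₁] ∪ [1−ν₃, ν₁]`).

**Deliberately NOT here:** the window/overlap form for a general recipe (needs formula I on reflected
profiles with recipe-dependent boundary constants = formula II for general `b`), `|S| ≠ 3`, error terms.
-/

noncomputable section

open Complex Real ComplexConjugate Set intervalIntegral
open _root_.MeasureTheory

namespace Literature.NumberTheory.LFunctions.Zhang2022

namespace Det

open Repair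

/-! ### The formula-II block with a glue recipe -/

/-- **Lemma 15.1's functional on the profile data:** `e_j(g) = g(0⁺) − iπb_j·∫g`, as a function of
`(b_j; g(0⁺), ∫g)` (printed `e′_{1j}, e_{2j}, e_{3j}`: `Repair.eR`, `Repair.eFun_side1/2`).
[cite: Zhang2022LandauSiegel, Lemma 15.1, (17.4)] -/
def eDet (bj : ℝ) (x0 Ix : ℂ) : ℂ := x0 - I * π * (bj : ℂ) * Ix

/-- **Formula II with glue recipe `W′` and shift multiples `b`:**
`F₀(a,b) = −i[Σ_j W′_j·e_j(a)·e_j(b) + a(0⁺)b(0⁺)]` on the data `(a(0⁺), ∫a; b(0⁺), ∫b)`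
(printed `W′ = (3,3,1)`: `Repair.F0gen`, `Repair.F0part_eq_weights`). [cite: Zhang2022LandauSiegel, Prop 14.1, Lemma 15.1, §18 (18.1)] -/
def F0Det (Wp : Fin 3 → ℂ) (b : Fin 3 → ℝ) (a0 Ia b0 Ib : ℂ) : ℂ :=
  -I * ((∑ j : Fin 3, Wp j * (eDet (b j) a0 Ia * eDet (b j) b0 Ib)) + a0 * b0)

/-- The printed glue weights `W′ = (3,3,1)` of formula II. [cite: Zhang2022LandauSiegel, §18 (18.1), Lemma 15.1] -/
def zhangGlueW : Fin 3 → ℂ := ![3, 3, 1]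

/-- **Faithfulness of the glue block:** with the printed glue weights and shift multiples, `F0Det` IS the
tree's `F0gen` (`−8i·ab − 12π(aI_b + I_a b) + 24π²i·I_aI_b`: `ΣW′ + 1 = 8`, `ΣW′_jb_j = 12`, `ΣW′_jb_j² = 24`).
[cite: Zhang2022LandauSiegel, §18 (18.1), Lemma 15.1, (17.4)] -/
theorem F0Det_zhang (α β Iu J : ℂ) : F0Det zhangGlueW zhangRecipe.b α Iu β J = F0gen α β Iu J := by
  simp only [F0Det, eDet, zhangGlueW, zhangRecipe, Fin.sum_univ_three, Matrix.cons_val_zero,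
    Matrix.cons_val_one, Matrix.cons_val_two, Matrix.head_cons, Matrix.tail_cons, F0gen]
  push_cast
  linear_combination (12 * (π : ℂ) * (α * J + Iu * β) - 24 * (π : ℂ) ^ 2 * I * (Iu * J)) * Complex.I_sq

/-- At the design data of `θ`: `F0Det zhangGlueW (1,2,3) (a₀, I_a; b₀, I_b) = F0part θ`.
[cite: Zhang2022LandauSiegel, §18 (18.1), (17.4)] -/
theorem F0Det_zhang_design (θ : Theta) :
    F0Det zhangGlueW zhangRecipe.b (a0T θ) (IaT θ) (b0T θ) (IbT θ) = F0part θ := by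
  rw [F0Det_zhang, F0gen_design]

/-! ### The candidate glue weights of a shift triple (shape only; formula II for general `b` is NOT derived) -/

/-- **CANDIDATE glue weights** `W′_j(b) = W_j(b)·n_j(b)/b_j` — the bookkeeping identity `j·W′_j = W_j·b′_j·b″_j`
recorded by the audit dictionary at the printed triple, continued with the typed formula-I weights
`Det.shiftW`. STATUS: shape for the registry; the formula-II residues for a general triple are NOT derived
(open, in-house). [cite: Zhang2022LandauSiegel, Prop 14.1, Lemma 15.1; Prop 7.1 p.44] -/
def shiftGlueW (b : Fin 3 → ℝ) (j : Fin 3) : ℂ := shiftW b j * (shiftN b j : ℂ) / (b j : ℂ)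

/-- `W′(1,2,3) = (3,3,1)`: `½·6/1`, `2·3/2`, `(3/2)·2/3`. [cite: Zhang2022LandauSiegel, §18 (18.1); Prop 7.1 p.44] -/
theorem shiftGlueW_std : shiftGlueW ![1, 2, 3] = zhangGlueW := by
  funext j
  simp only [shiftGlueW, shiftW_std, shiftN_std, zhangGlueW]
  fin_cases j <;> (simp; try norm_num)

/-! ### The two-sided recipe form (no overlap term) and its faithfulness on the admissible class -/

/-- **The two-sided (glued) main-term form of a detector recipe, WITHOUT the window term:**
`𝔅_R(g₁) + 𝔅_R(g₂) + 2Re F₀_{W′,b}(g₁(0), ∫₀¹g₁; g₂(0), ∫₀¹g₂)` for side-1 profile `g₁` and (unreflected) side-2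
profile `g₂` — exact when the supports do not overlap after reflection (`ν₁ + ν₂ ≤ 1`); otherwise the window
form over the overlaps must be added (`Repair.WT` at the printed recipe; not typed for general `R`).
[cite: Zhang2022LandauSiegel, §8 (8.2); §18 (18.1); §12 (12.6)–(12.8)] -/
def FormDetTwoSided (R : DetRecipe) (Wp : Fin 3 → ℂ) (g₁ g₁' g₂ g₂' : ℝ → ℂ) : ℝ :=
  FormDet R g₁ g₁' + FormDet R g₂ g₂'
    + 2 * (F0Det Wp R.b (g₁ 0) (∫ x in (0:ℝ)..1, g₁ x) (g₂ 0) (∫ x in (0:ℝ)..1, g₂ x)).re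

variable {θ : Theta}

/-- **Faithfulness on the admissible class:** at the printed recipe and the design profiles of `θ`
(`Repair.h1Profile`, `Repair.h2Profile`), the two-sided recipe form is `Re 𝔠₁T + Re 𝔠₂T + 2Re F0part` — the
transcribed pair blocks plus the formula-II block. [cite: Zhang2022LandauSiegel, §8 (8.2), (8.23); §9 (9.7); §18 (18.1)] -/
theorem FormDetTwoSided_zhang (h : AdmissibleTheta θ) :
    FormDetTwoSided zhangRecipe zhangGlueW (h1Profile θ) (h1Profile' θ) (h2Profile θ) (h2Profile' θ)
      = (frakc1T θ).re + (frakc2T θ).re + 2 * (F0part θ).re := by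
  rw [FormDetTwoSided, FormDet_zhang (kinkedProfile_h1Profile h) (h1Profile_one h),
    FormDet_zhang (kinkedProfile_h2Profile h) (h2Profile_one h), h1Profile_zero h, h2Profile_zero h,
    integral_h1Profile h, integral_h2Profile h, F0Det_zhang_design, frakc1T_eq_mainTermForm h,
    frakc2T_eq_mainTermForm h, Complex.ofReal_re, Complex.ofReal_re]

/-- **… and equals the §18 functional of record minus exactly the window form:**
`FormDetTwoSided (printed) = C232S θ − 2Re WT θ` (`Repair.C232S_eq_frakc`, `Repair.frakc3S_eq`). The printed
class `R` overlaps (`ν₁ + ν₃ > 1`), so `WT ≠ 0` there in general; the no-overlap reading is exact only for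
`ν₁ + ν₂ ≤ 1`. [cite: Zhang2022LandauSiegel, §8 (8.2); §12 (12.12)–(12.17); §18 (18.1)] -/
theorem FormDetTwoSided_zhang_eq_C232S_sub (h : AdmissibleTheta θ) :
    FormDetTwoSided zhangRecipe zhangGlueW (h1Profile θ) (h1Profile' θ) (h2Profile θ) (h2Profile' θ)
      = C232S θ - 2 * (WT θ).re := by
  rw [FormDetTwoSided_zhang h, C232S_eq_frakc h, frakc3S_eq h, Complex.add_re]
  ring

/-! ### The glue block with a FREE diagonal coefficient (test slot for the open formula-II derivation)

STATUS NOTE (appended 2026-08-26, cell numerics of record): the candidate glue weights `shiftGlueW b = W_j n_j/b_j`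
above, combined with the unit `a(0⁺)b(0⁺)` coefficient of `F0Det`, are REFUTED as the general-`b` formula-II block by
a (B1)-consistency scan of `FormDetTwoSided` on the no-overlap two-sided class (ls-Bdet-num-2, kit j257113:
sign-admissible `(1,3,4)`, `(½,2,3)`, `(¼,2,3)` give an INDEFINITE form — impossible for the true main term of a
non-negatively weighted discrete form by `Det.discreteForm_mainOrder_norm_sq_le`). They remain the printed values at
`b = (1,2,3)` (`shiftGlueW_std`, `F0Det_zhang`). The true `(W′_j(b), c(b))` await the formula-II derivation for a
general triple; `F0DetC` below is the typed slot for such a pair. -/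

/-- **Formula-II block with glue recipe `W′`, shift multiples `b` AND a free diagonal coefficient `c₀`:**
`F₀ = −i[Σ_j W′_j·e_j(a)·e_j(b) + c₀·a(0⁺)b(0⁺)]` (`c₀ = 1` printed: `F0DetC_one`). The pair `(W′(b), c₀(b))` for a
general triple is the OPEN formula-II derivation target; this is its typed slot (the cell's two-sided scans take
`(W′, c₀)` as input). [cite: Zhang2022LandauSiegel, Prop 14.1, Lemma 15.1, §18 (18.1)] -/
def F0DetC (Wp : Fin 3 → ℂ) (c0 : ℂ) (b : Fin 3 → ℝ) (a0 Ia b0 Ib : ℂ) : ℂ :=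
  -I * ((∑ j : Fin 3, Wp j * (eDet (b j) a0 Ia * eDet (b j) b0 Ib)) + c0 * (a0 * b0))

/-- `c₀ = 1` is the block `F0Det`. [cite: Zhang2022LandauSiegel, §18 (18.1), (17.4)] -/
theorem F0DetC_one (Wp : Fin 3 → ℂ) (b : Fin 3 → ℝ) (a0 Ia b0 Ib : ℂ) :
    F0DetC Wp 1 b a0 Ia b0 Ib = F0Det Wp b a0 Ia b0 Ib := by
  simp only [F0DetC, F0Det, one_mul]

/-- **The two-sided recipe form with the free glue pair `(W′, c₀)`** (no window term):
`𝔅_R(g₁) + 𝔅_R(g₂) + 2Re F₀^{(c₀)}_{W′,b}(g₁(0), ∫g₁; g₂(0), ∫g₂)`. [cite: Zhang2022LandauSiegel, §8 (8.2); §18 (18.1)] -/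
def FormDetTwoSidedC (R : DetRecipe) (Wp : Fin 3 → ℂ) (c0 : ℂ) (g₁ g₁' g₂ g₂' : ℝ → ℂ) : ℝ :=
  FormDet R g₁ g₁' + FormDet R g₂ g₂'
    + 2 * (F0DetC Wp c0 R.b (g₁ 0) (∫ x in (0:ℝ)..1, g₁ x) (g₂ 0) (∫ x in (0:ℝ)..1, g₂ x)).re

/-- `c₀ = 1` recovers `FormDetTwoSided`. [cite: Zhang2022LandauSiegel, §8 (8.2); §18 (18.1)] -/
theorem formDetTwoSidedC_one (R : DetRecipe) (Wp : Fin 3 → ℂ) (g₁ g₁' g₂ g₂' : ℝ → ℂ) :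
    FormDetTwoSidedC R Wp 1 g₁ g₁' g₂ g₂' = FormDetTwoSided R Wp g₁ g₁' g₂ g₂' := by
  simp only [FormDetTwoSidedC, FormDetTwoSided, F0DetC_one]

/-- At the printed data `(W′, c₀, b) = ((3,3,1), 1, (1,2,3))` the free-coefficient two-sided form is the functional of
record minus the window form, on the admissible class. [cite: Zhang2022LandauSiegel, §8 (8.2); §12 (12.12)–(12.17); §18 (18.1)] -/
theorem formDetTwoSidedC_zhang_eq_C232S_sub (h : AdmissibleTheta θ) :
    FormDetTwoSidedC zhangRecipe zhangGlueW 1 (h1Profile θ) (h1Profile' θ) (h2Profile θ) (h2Profile' θ)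
      = C232S θ - 2 * (WT θ).re := by
  rw [formDetTwoSidedC_one, FormDetTwoSided_zhang_eq_C232S_sub h]

/-! ### The cell's general-`b` glue PAIR `(W′, c₀) = (W·n/b, −e^{iπΣb/2})` (derivation-by-consistency, two lineages)

STATUS NOTE (appended 2026-08-26, third): two code-disjoint numerics lineages of the cell arrive at the SAME glue
pair for a general sign-admissible triple `b`: the weights `W′_j(b) = W_j(b)·n_j(b)/b_j` (= `shiftGlueW`, kept as
typed) TOGETHER WITH the diagonal coefficient `c₀(b) = −e^{iπΣb/2}` in place of `1` — lineage A from
split-independence of the cross term plus the AFE-null identities (ls-Bdet-num-1, GLUE-NOTE.md dcaf12ad47a2ec71,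
kits j257206/j257420/j257504), lineage B by pinning `c₀` as the unique value making the glued form (B1)-consistent
(PSD with kernel) on the lattice triples, then nonneg-type on 144/144 admissible quarter-grid triples (ls-Bdet-num-2,
kits j257517/j257574/j257615). The constant carries the same global phase `e^{iπΣb/2}` as the formula-I weights
`Det.shiftW` (the common prefactor `(pt₀)^{Σβ/2}` of `𝔠`, Lemma 5.2). At `b = (1,2,3)`: `−e^{3πi} = 1`, the printed
block (`shiftGlue0_std`, `formDetGlued_std`). DERIVATION STATUS: «derivation (in-house, by consistency on two
lineages); desk review of formula II at general `b` pending» — typed here as DESIGN DATA (a definition the cell's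
scans and registry rows name), never asserted to be the manuscript's main term; so refuted above is only the pair
`(shiftGlueW, 1)`, not `shiftGlueW`. -/

/-- **The cell's glue constant of a shift triple:** `c₀(b) = −exp(iπ·(Σ_j b_j)/2)`, the coefficient of `a(0⁺)b(0⁺)` in
the formula-II block that the cell pairs with `shiftGlueW b` (module STATUS NOTE: numerically the unique
(B1)-consistent constant on the quarter grid, two lineages; derivation review pending). For integer `Σb` it is
`−(−1)^{Σb}`-periodic data: `+1` for `Σb ≡ 2 (mod 4)` (printed `Σb = 6`), `−1` for `Σb ≡ 0 (mod 4)`.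
[cite: Zhang2022LandauSiegel, Lemma 5.2 p.10; Prop 14.1; Lemma 15.1; §18 (18.1)] -/
def shiftGlue0 (b : Fin 3 → ℝ) : ℂ := -cexp (I * π * (((∑ j : Fin 3, b j) / 2 : ℝ) : ℂ))

/-- `‖c₀(b)‖ = 1` for every triple (a pure phase). [cite: Zhang2022LandauSiegel, Lemma 5.2 p.10] -/
theorem norm_shiftGlue0 (b : Fin 3 → ℝ) : ‖shiftGlue0 b‖ = 1 := by
  rw [shiftGlue0, norm_neg, show I * π * ((((∑ j : Fin 3, b j) / 2 : ℝ)) : ℂ)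
      = ((π * ((∑ j : Fin 3, b j) / 2) : ℝ) : ℂ) * I by push_cast; ring, Complex.norm_exp_ofReal_mul_I]

/-- At the printed triple `c₀(1,2,3) = −e^{3πi} = 1`: the printed unit coefficient of `a(0⁺)b(0⁺)` (`F0Det`, `Repair.F0gen`).
[cite: Zhang2022LandauSiegel, §18 (18.1), Lemma 15.1, (17.4)] -/
theorem shiftGlue0_std : shiftGlue0 ![1, 2, 3] = 1 := by
  rw [shiftGlue0, Fin.sum_univ_three]
  simp only [Matrix.cons_val_zero, Matrix.cons_val_one, Matrix.cons_val_two, Matrix.head_cons,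
    Matrix.tail_cons]
  rw [show (((1 + 2 + 3) / 2 : ℝ) : ℂ) = 3 by push_cast; norm_num,
    show I * π * (3 : ℂ) = π * I + 2 * π * I by ring, Complex.exp_add, Complex.exp_pi_mul_I,
    Complex.exp_two_pi_mul_I]
  norm_num

/-- Lattice value `c₀(1,3,4) = −e^{4πi} = −1` (`Σb = 8 ≡ 0 mod 4`; the sign lineage B's oracle pins at this triple).
[cite: Zhang2022LandauSiegel, Lemma 5.2 p.10] -/
theorem shiftGlue0_134 : shiftGlue0 ![1, 3, 4] = -1 := by
  rw [shiftGlue0, Fin.sum_univ_three]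
  simp only [Matrix.cons_val_zero, Matrix.cons_val_one, Matrix.cons_val_two, Matrix.head_cons,
    Matrix.tail_cons]
  rw [show (((1 + 3 + 4) / 2 : ℝ) : ℂ) = 4 by push_cast; norm_num,
    show I * π * (4 : ℂ) = (2 : ℕ) * (2 * π * I) by push_cast; ring, Complex.exp_nat_mul,
    Complex.exp_two_pi_mul_I]
  norm_num

/-- Lattice value `c₀(1,4,5) = −e^{5πi} = 1` (`Σb = 10 ≡ 2 mod 4`). [cite: Zhang2022LandauSiegel, Lemma 5.2 p.10] -/
theorem shiftGlue0_145 : shiftGlue0 ![1, 4, 5] = 1 := by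
  rw [shiftGlue0, Fin.sum_univ_three]
  simp only [Matrix.cons_val_zero, Matrix.cons_val_one, Matrix.cons_val_two, Matrix.head_cons,
    Matrix.tail_cons]
  rw [show (((1 + 4 + 5) / 2 : ℝ) : ℂ) = 5 by push_cast; norm_num,
    show I * π * (5 : ℂ) = π * I + (2 : ℕ) * (2 * π * I) by push_cast; ring, Complex.exp_add,
    Complex.exp_nat_mul, Complex.exp_pi_mul_I, Complex.exp_two_pi_mul_I]
  norm_num

/-- **The glued (two-sided, no window term) main-term form of a shift triple with the cell's glue pair:**
`FormDetGlued b := FormDetTwoSidedC (shiftRecipe b) (shiftGlueW b) (shiftGlue0 b)`, i.e.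
`𝔅_{R(b)}(g₁) + 𝔅_{R(b)}(g₂) + 2Re(−i[Σ_j W′_j(b) e_j(g₁)e_j(g₂) + c₀(b)·g₁(0)g₂(0)])` — the object the cell's
two-sided det rows evaluate (exact for non-overlapping supports `ν₁ + ν₂ ≤ 1`). Design data; its (A)-world
meaning is the registry's «formula II at general b» row (derivation under review), not a claim made here.
[cite: Zhang2022LandauSiegel, §8 (8.2); Prop 14.1; Lemma 15.1; §18 (18.1)] -/
def FormDetGlued (b : Fin 3 → ℝ) (g₁ g₁' g₂ g₂' : ℝ → ℂ) : ℝ :=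
  FormDetTwoSidedC (shiftRecipe b) (shiftGlueW b) (shiftGlue0 b) g₁ g₁' g₂ g₂'

/-- **At the printed triple the glued form is the printed two-sided form** (`(W′, c₀, R) = ((3,3,1), 1, zhangRecipe)`).
[cite: Zhang2022LandauSiegel, §8 (8.2); §18 (18.1)] -/
theorem formDetGlued_std (g₁ g₁' g₂ g₂' : ℝ → ℂ) :
    FormDetGlued ![1, 2, 3] g₁ g₁' g₂ g₂' = FormDetTwoSided zhangRecipe zhangGlueW g₁ g₁' g₂ g₂' := by
  rw [FormDetGlued, shiftGlue0_std, shiftGlueW_std, shiftRecipe_std, formDetTwoSidedC_one]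

/-- … hence on the admissible class `R` it is the §18 functional of record minus exactly the window form:
`FormDetGlued (1,2,3) (h₁, h₂ of θ) = C232S θ − 2Re WT θ`. [cite: Zhang2022LandauSiegel, §8 (8.2); §12 (12.12)–(12.17); §18 (18.1)] -/
theorem formDetGlued_std_eq_C232S_sub (h : AdmissibleTheta θ) :
    FormDetGlued ![1, 2, 3] (h1Profile θ) (h1Profile' θ) (h2Profile θ) (h2Profile' θ)
      = C232S θ - 2 * (WT θ).re := by
  rw [formDetGlued_std, FormDetTwoSided_zhang_eq_C232S_sub h]

/-! ### The ASSEMBLY step of the cell's formula-II derivation at general `b`, kernel-checked (GLUE-DERIVATION.md §1(f))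

STATUS NOTE (appended 2026-08-26, fourth): the cell now holds an in-house DERIVATION of the pair `(W·n/b, −e^{iπΣb/2})`
from the manuscript's own §§13–17 with the shift phases kept symbolic (ls-barrier-num, `barrier/num/GLUE-DERIVATION.md`
sha16 7fb0df07be14a4c2; review: ls-theory): §13 contributes `Φ₀ = Φ((b₀+b₁−b₂)/2)` (`Φ(x) := e^{iπx}`), §15 the
coefficients `u_j = N·Φ(b₂−b_j)/v_j` (`N = b₀b₁`, `v_j = Π_{i≠j}(b_i−b_j)`), §16 the pair `Φ(b₂−b₁)·(v¹, v²)` with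
`v¹ = b₀Φ(b₁−b₀)/(b₁−b₀)`, `v² = −b₀/(b₁−b₀)`, §17 the terms `−Φ(b₂)·𝔢₀ + Φ(b₂−b₀)·𝔢(b₀)` (channels here are
`(0,1,2)` = the note's `(1,2,3)`, channel `0` the sub-gap shift). The reading of the residues (§1(a)–(e) of the note) is
the derivation under review; the final ASSEMBLY §1(f) — that these pieces sum to `Σ_j W′_j(b)𝔢(b_j) − e^{iπΣb/2}𝔢₀` with
`W′_j = W_j n_j/b_j` — is pure algebra and is PROVED below (`glueAssembled_eq`), for every pairwise-distinct triple with
non-zero entries. -/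

/-- The phase `Φ(x) = e^{iπx}` of the shift bookkeeping (`(pt₀)^{iαx} → e^{iπx}`, (2.10)). [cite: Zhang2022LandauSiegel, §2 (2.10); Lemma 5.2 p.10] -/
def glPhase (x : ℝ) : ℂ := cexp (I * π * (x : ℂ))

/-- `Φ(x)Φ(y) = Φ(x+y)`. [cite: Zhang2022LandauSiegel, §2 (2.10)] -/
theorem glPhase_mul (x y : ℝ) : glPhase x * glPhase y = glPhase (x + y) := by
  rw [glPhase, glPhase, glPhase, ← Complex.exp_add]
  push_cast
  ring_nf

/-- `Φ(x) ≠ 0`. [cite: Zhang2022LandauSiegel, §2 (2.10)] -/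
theorem glPhase_ne_zero (x : ℝ) : glPhase x ≠ 0 := Complex.exp_ne_zero _

/-- The formula-I weight in phase notation: `W_j(b) = b_j·Φ((s_j − b_j)/2)/v_j`. [cite: Zhang2022LandauSiegel, proof of Prop 7.1, (7.19)–(7.21)] -/
theorem shiftW_eq_glPhase (b : Fin 3 → ℝ) (j : Fin 3) :
    shiftW b j = (b j : ℂ) * glPhase ((shiftS b j - b j) / 2) / (shiftVdm b j : ℂ) := rfl

/-- The glue constant in phase notation: `c₀(b) = −Φ(Σb/2)`. [cite: Zhang2022LandauSiegel, Lemma 5.2 p.10] -/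
theorem shiftGlue0_eq_glPhase (b : Fin 3 → ℝ) : shiftGlue0 b = -glPhase ((∑ j : Fin 3, b j) / 2) := rfl

/-- **§13's prefactor** `Φ₀ = Φ((b₀+b₁−b₂)/2)` (from `(pt₀)^{(β₁+β₂−β₃)/2}`; `= 1` in print). [cite: Zhang2022LandauSiegel, §13 (13.1); Lemma 5.2] -/
def gluePhi0 (b : Fin 3 → ℝ) : ℂ := glPhase ((b 0 + b 1 - b 2) / 2)

/-- **§15's coefficients** `u_j = N·Φ(b₂−b_j)/v_j`, `N = b₀b₁` (printed `(1,2,1)`). [cite: Zhang2022LandauSiegel, §15 (15.16), (15.24)] -/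
def glueU (b : Fin 3 → ℝ) (j : Fin 3) : ℂ := (shiftN b 2 : ℂ) * glPhase (b 2 - b j) / (shiftVdm b j : ℂ)

/-- **§16's coefficients** `v¹ = b₀Φ(b₁−b₀)/(b₁−b₀)` and `v² = −b₀/(b₁−b₀)` (printed `−1, −1`). [cite: Zhang2022LandauSiegel, §16 (16.17)] -/
def glueV (b : Fin 3 → ℝ) : Fin 2 → ℂ :=
  ![(b 0 : ℂ) * glPhase (b 1 - b 0) / ((b 1 - b 0 : ℝ) : ℂ), -(b 0 : ℂ) / ((b 1 - b 0 : ℝ) : ℂ)]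

/-- **The cell's ASSEMBLED §13 cross block at general `b`** (GLUE-DERIVATION.md §1(f), before simplification):
`−i·Φ₀·{Σ_j u_j𝔢_j + Φ(b₂−b₁)(v¹𝔢₀ + v²𝔢₁) − Φ(b₂)𝔢* + Φ(b₂−b₀)𝔢₀}` on channel functionals `𝔢_j` and the apex
product `𝔢*` (`= a(0⁺)b(0⁺)`). [cite: Zhang2022LandauSiegel, §13 (13.7)–(13.10); §15 (15.24); §16 (16.17); §17 (17.10)] -/
def glueAssembled (b : Fin 3 → ℝ) (e : Fin 3 → ℂ) (e0 : ℂ) : ℂ :=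
  -I * gluePhi0 b *
    ((∑ j : Fin 3, glueU b j * e j) + glPhase (b 2 - b 1) * (glueV b 0 * e 0 + glueV b 1 * e 1)
      - glPhase (b 2) * e0 + glPhase (b 2 - b 0) * e 0)

variable {b : Fin 3 → ℝ}

/-- Coefficient of the apex product: `−Φ₀·Φ(b₂) = c₀(b) = −e^{iπΣb/2}`. [cite: Zhang2022LandauSiegel, §17 (17.6); Lemma 5.2] -/
theorem glueCoeff_apex (b : Fin 3 → ℝ) : -(gluePhi0 b * glPhase (b 2)) = shiftGlue0 b := by
  rw [gluePhi0, glPhase_mul, shiftGlue0_eq_glPhase, Fin.sum_univ_three]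
  congr 2
  ring

/-- Coefficient of `𝔢₂`: `Φ₀·u₂ = W′₂ = W₂n₂/b₂`. [cite: Zhang2022LandauSiegel, §15 (15.24); Prop 14.1] -/
theorem glueCoeff_two (h2 : b 2 ≠ 0) : gluePhi0 b * glueU b 2 = shiftGlueW b 2 := by
  have hphase : glPhase (b 2 - b 2) = 1 := by rw [sub_self, glPhase]; simp
  rw [glueU, hphase, shiftGlueW, shiftW_eq_glPhase, gluePhi0]
  have hs : (shiftS b 2 - b 2) / 2 = (b 0 + b 1 - b 2) / 2 := by simp [shiftS]
  rw [hs]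
  have hb2 : (b 2 : ℂ) ≠ 0 := by exact_mod_cast h2
  field_simp

/-- Coefficient of `𝔢₁`: `Φ₀·(u₁ + Φ(b₂−b₁)v²) = W′₁ = W₁n₁/b₁`. [cite: Zhang2022LandauSiegel, §15 (15.24); §16 (16.17); Prop 14.1] -/
theorem glueCoeff_one (h01 : b 0 ≠ b 1) (h12 : b 1 ≠ b 2) (h1 : b 1 ≠ 0) :
    gluePhi0 b * (glueU b 1 + glPhase (b 2 - b 1) * glueV b 1) = shiftGlueW b 1 := by
  have hph : gluePhi0 b * glPhase (b 2 - b 1) = glPhase ((shiftS b 1 - b 1) / 2) := by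
    rw [gluePhi0, glPhase_mul]; congr 1; simp [shiftS]; ring
  rw [shiftGlueW, shiftW_eq_glPhase, ← hph, glueU, glueV]
  simp only [Matrix.cons_val_one, Matrix.head_cons, shiftN, shiftVdm, Matrix.cons_val_two, Matrix.tail_cons]
  have hb1 : (b 1 : ℂ) ≠ 0 := by exact_mod_cast h1
  have hv1 : ((b 2 - b 1 : ℝ) : ℂ) ≠ 0 := by exact_mod_cast sub_ne_zero.2 h12.symm
  have hv2 : ((b 0 - b 1 : ℝ) : ℂ) ≠ 0 := by exact_mod_cast sub_ne_zero.2 h01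
  have hv3 : ((b 1 - b 0 : ℝ) : ℂ) ≠ 0 := by exact_mod_cast sub_ne_zero.2 h01.symm
  push_cast at hv1 hv2 hv3 ⊢
  field_simp
  ring

/-- Coefficient of `𝔢₀` (the sub-gap channel): `Φ₀·(u₀ + Φ(b₂−b₁)v¹ + Φ(b₂−b₀)) = W′₀ = W₀n₀/b₀`.
[cite: Zhang2022LandauSiegel, §15 (15.24); §16 (16.17); §17 (17.10); Prop 14.1] -/
theorem glueCoeff_zero (h01 : b 0 ≠ b 1) (h02 : b 0 ≠ b 2) (h0 : b 0 ≠ 0) :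
    gluePhi0 b * (glueU b 0 + glPhase (b 2 - b 1) * glueV b 0 + glPhase (b 2 - b 0)) = shiftGlueW b 0 := by
  have hph1 : gluePhi0 b * glPhase (b 2 - b 0) = glPhase ((shiftS b 0 - b 0) / 2) := by
    rw [gluePhi0, glPhase_mul]; congr 1; simp [shiftS]; ring
  have hph2 : glPhase (b 2 - b 1) * glPhase (b 1 - b 0) = glPhase (b 2 - b 0) := by
    rw [glPhase_mul]; congr 1; ring
  rw [shiftGlueW, shiftW_eq_glPhase, ← hph1, glueU, glueV]
  simp only [Matrix.cons_val_zero, shiftN, shiftVdm, Matrix.cons_val_two, Matrix.tail_cons, Matrix.head_cons]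
  rw [show glPhase (b 2 - b 1) * ((b 0 : ℂ) * glPhase (b 1 - b 0) / ((b 1 - b 0 : ℝ) : ℂ))
      = (b 0 : ℂ) * (glPhase (b 2 - b 1) * glPhase (b 1 - b 0)) / ((b 1 - b 0 : ℝ) : ℂ) by ring, hph2]
  have hb0 : (b 0 : ℂ) ≠ 0 := by exact_mod_cast h0
  have hv1 : ((b 1 - b 0 : ℝ) : ℂ) ≠ 0 := by exact_mod_cast sub_ne_zero.2 h01.symm
  have hv2 : ((b 2 - b 0 : ℝ) : ℂ) ≠ 0 := by exact_mod_cast sub_ne_zero.2 h02.symm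
  push_cast at hv1 hv2 ⊢
  field_simp
  ring

/-- **ASSEMBLY (GLUE-DERIVATION.md §1(f)), kernel-checked:** for a pairwise-distinct triple with non-zero entries, the
assembled §13 block equals the glue block with the cell's pair, `−i[Σ_j W′_j(b)𝔢_j + c₀(b)𝔢*]`, `W′ = shiftGlueW b`,
`c₀ = shiftGlue0 b`. [cite: Zhang2022LandauSiegel, §§13–17: (13.7)–(13.10), (15.24), (16.17), (17.10); §18 (18.1)] -/
theorem glueAssembled_eq (hinj : Function.Injective b) (hne : ∀ j, b j ≠ 0) (e : Fin 3 → ℂ) (e0 : ℂ) :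
    glueAssembled b e e0 = -I * ((∑ j : Fin 3, shiftGlueW b j * e j) + shiftGlue0 b * e0) := by
  have h01 : b 0 ≠ b 1 := fun h => absurd (hinj h) (by decide)
  have h02 : b 0 ≠ b 2 := fun h => absurd (hinj h) (by decide)
  have h12 : b 1 ≠ b 2 := fun h => absurd (hinj h) (by decide)
  rw [glueAssembled, Fin.sum_univ_three, Fin.sum_univ_three, ← glueCoeff_zero h01 h02 (hne 0),
    ← glueCoeff_one h01 h12 (hne 1), ← glueCoeff_two (hne 2), ← glueCoeff_apex b]
  ring

/-- … i.e. on profile data it IS the free-pair glue block with the cell's pair: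
`glueAssembled b (e_j(a)e_j(b)) (a(0)b(0)) = F0DetC (shiftGlueW b) (shiftGlue0 b) b …`.
[cite: Zhang2022LandauSiegel, Prop 14.1; Lemma 15.1; §18 (18.1)] -/
theorem glueAssembled_eq_F0DetC (hinj : Function.Injective b) (hne : ∀ j, b j ≠ 0) (a0 Ia b0 Ib : ℂ) :
    glueAssembled b (fun j => eDet (b j) a0 Ia * eDet (b j) b0 Ib) (a0 * b0)
      = F0DetC (shiftGlueW b) (shiftGlue0 b) b a0 Ia b0 Ib := by
  rw [glueAssembled_eq hinj hne, F0DetC]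

/-- The printed values of the pieces: `Φ₀ = 1`, `u = (1,2,1)`, `Φ(b₂−b₁)·(v¹, v²) = (−1)·(−1, −1)`, `Φ(b₂) = −1`,
`Φ(b₂−b₀) = 1` at `b = (1,2,3)` — so the assembled block is `−i(3𝔢₀ + 3𝔢₁ + 𝔢₂ + 𝔢*)`, (18.1) verbatim.
[cite: Zhang2022LandauSiegel, §18 (18.1); (15.24); (16.17); (17.10)] -/
theorem glueAssembled_std (e : Fin 3 → ℂ) (e0 : ℂ) :
    glueAssembled ![1, 2, 3] e e0 = -I * (3 * e 0 + 3 * e 1 + e 2 + e0) := by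
  have hinj : Function.Injective (![1, 2, 3] : Fin 3 → ℝ) := by
    intro i j h
    fin_cases i <;> fin_cases j <;> first | rfl | simp at h
  have hne : ∀ j : Fin 3, (![1, 2, 3] : Fin 3 → ℝ) j ≠ 0 := by
    intro j
    fin_cases j <;> norm_num
  rw [glueAssembled_eq hinj hne, shiftGlueW_std, shiftGlue0_std, Fin.sum_univ_three]
  simp only [zhangGlueW, Matrix.cons_val_zero, Matrix.cons_val_one, Matrix.cons_val_two, Matrix.head_cons,
    Matrix.tail_cons]
  ring

end Det

end Literature.NumberTheory.LFunctions.Zhang2022
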